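import Literature.MathematicalPhysics.QuantumFieldTheory.SUNBakryEmeryPoincare

/-!
# Strong-coupling front, J-SC12 (part 1/3): the curvature–dimension inequality `CD(ρ, m)` of the
one-link Gibbs measure on `SU(2)` — observatory of the non-perturbative crossover; no mass-gap claim

IR-3 v2 TWO-FRONT CROSSOVER LEDGER, front SC (`β₀`), SU(2), `d = 4`, Wilson normalisation `β_W = 4/g²`.
observatory of the non-perturbative crossover; no mass-gap claim.

ABSOLUTE RULE. No internally-minted statement may enter as a cited fact. Every hypothesis is either
kernel-proved in this package or a verbatim quotation of a PUBLISHED theorem with page reference. The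
manuscript(s) under audit are NOT citable for their own disputed steps — they are the thing under
adjudication; programme-internal (2001/route/tribunal) claims are never citable.  THIS FILE HAS NO
HYPOTHESES: every statement below is kernel-proved from the tree; names of published results appear as
ATTRIBUTION only (Bochner–Lichnerowicz–Bakry–Émery curvature–dimension argument).

WHAT THIS FILE PROVES (all in the tree's frame calculus `SUNBakryEmery.matD/Gam/Lap/genL/Gam2` on
`M₂(ℂ) ⊃ SU(2)`, potential `S = c Re tr(· B)`):
* `sum_frame_two`: sums over the tree's (overcomplete, 8-element) Parseval frame of `𝔰𝔲(2)` reduce to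
  the core `{A, B, C} = {frameA 0 1, frameB 0 1, frameB 0 0}` with weight `2`;
* `sum_sum_hess_potential_two`: the Hessian term of Bochner's formula is EXACT at `N = 2`:
  `∑ D_αu D_βu D_αD_βS = -(S/2) Γ(u,u)` (since `Z² = -(‖Z‖_F²/2)·1` on `𝔰𝔲(2)`);
* `Gam_add_Lap_sq_le`: the dimensional term `Γ(u,u) + (Δu)²/3 ≤ ∑ (D_αD_βu)²` (`dim = 3`, `Ric = 1`);
* `Gam_potential_add_sq_le`: `Γ(S,S) + S²/2 ≤ c²‖B‖_F²` on `U(2)` (Bessel);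
* `Gam2_potential_ge_dim`: the pointwise condition `CD(1 - t/8 - c²‖B‖_F²/t, t + 3)` for every `t > 0`,
  in product form; `integral_exp_mul_Gam_le_dim`: its integrated form
  `(8t - t² - 8c²‖B‖_F²)(t+3) ∫ e^S Γ(u,u) ≤ 8t(t+2) ∫ e^S (L_S u)²`.
Parts 2/3 (`StrongCouplingDimensionalPoincare`, `StrongCouplingDimensionalWindow`) turn this into the
hypothesis-free window `696 β_W² < 13` (`β_W < 0.13667`) of the ledger, past Bakry–Émery's `0.12440`.
-/

noncomputable section

open scoped Matrix ComplexConjugate BigOperators Matrix.Norms.Frobenius ContDiff Topology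
open Matrix Complex Finset MeasureTheory
open Literature.MathematicalPhysics.QuantumFieldTheory
open Literature.MathematicalPhysics.QuantumFieldTheory.SUNBakryEmery

namespace Summit.QuantumFields.BalabanUV.InfraRed.StrongCouplingDimensionalCurvature

/-- **Cayley–Hamilton for a traceless `2 × 2` matrix**: `M² = (tr(M²)/2)·1`. [folklore] -/
private theorem mul_self_eq_smul_one_of_trace_zero (M : Matrix (Fin 2) (Fin 2) ℂ) (h0 : M.trace = 0) :
    M * M = ((M * M).trace / 2) • (1 : Matrix (Fin 2) (Fin 2) ℂ) := by
  rw [Matrix.trace_fin_two] at h0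
  have h11 : M 1 1 = -M 0 0 := by linear_combination h0
  ext i j
  fin_cases i <;> fin_cases j <;>
    simp [Matrix.mul_apply, Fin.sum_univ_two, Matrix.trace_fin_two, h11] <;> ring

/-- For `Z ∈ 𝔰𝔲(2)` (skew-Hermitian, traceless): `Z² = -(‖Z‖_F²/2)·1`. [folklore] -/
theorem mul_self_eq_of_su2 {Z : Matrix (Fin 2) (Fin 2) ℂ} (hZ : Zᴴ = -Z) (hZ0 : Z.trace = 0) :
    Z * Z = ((-(frobNorm Z ^ 2 / 2) : ℝ) : ℂ) • (1 : Matrix (Fin 2) (Fin 2) ℂ) := by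
  rw [mul_self_eq_smul_one_of_trace_zero Z hZ0]
  congr 1
  rw [trace_mul_eq_re_of_skew hZ hZ, frobNorm_sq_of_skew hZ]
  push_cast
  ring

/-- **The `N = 2` Hessian identity**: for `Z ∈ 𝔰𝔲(2)` and any `Q, B`,
`Re tr(Q Z Z B) = -(‖Z‖_F²/2) Re tr(Q B)`. [folklore] -/
theorem re_trace_mul_mul_mul_of_su2 {Z : Matrix (Fin 2) (Fin 2) ℂ} (hZ : Zᴴ = -Z) (hZ0 : Z.trace = 0)
    (Q B : Matrix (Fin 2) (Fin 2) ℂ) :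
    (Q * Z * Z * B).trace.re = -(frobNorm Z ^ 2 / 2) * (Q * B).trace.re := by
  have e : Q * Z * Z * B = ((-(frobNorm Z ^ 2 / 2) : ℝ) : ℂ) • (Q * B) := by
    rw [Matrix.mul_assoc Q Z Z, mul_self_eq_of_su2 hZ hZ0, Matrix.mul_smul, Matrix.mul_one, Matrix.smul_mul]
  rw [e, trace_smul, smul_eq_mul, Complex.re_ofReal_mul]

/-- `E₀₀ + E₁₁ = 1` in `M₂(ℂ)`. [folklore] -/
private theorem E_zero_zero_add_E_one_one : E (0 : Fin 2) 0 + E 1 1 = (1 : Matrix (Fin 2) (Fin 2) ℂ) := by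
  ext i j
  fin_cases i <;> fin_cases j <;> simp [E, Matrix.single]

/-- `frameA j j = 0`. [folklore] -/
private theorem frameA_self (j : Fin 2) : frameA (N := 2) j j = 0 := by
  simp [frameA]

/-- `frameA 1 0 = -frameA 0 1`. [folklore] -/
private theorem frameA_one_zero : frameA (N := 2) 1 0 = -frameA 0 1 := by
  show (1 / 2 : ℂ) • (E (1 : Fin 2) 0 - E 0 1) = -((1 / 2 : ℂ) • (E (0 : Fin 2) 1 - E 1 0))
  rw [← smul_neg, neg_sub]

/-- `frameB 1 0 = frameB 0 1`. [folklore] -/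
private theorem frameB_one_zero : frameB (N := 2) 1 0 = frameB 0 1 := by
  have hC1 : frameC (N := 2) 1 0 = 0 := by simp [frameC]
  have hC2 : frameC (N := 2) 0 1 = 0 := by simp [frameC]
  rw [frameB, frameB, hC1, hC2, frameB0, frameB0, add_comm]

/-- `frameB 1 1 = -frameB 0 0`. [folklore] -/
private theorem frameB_one_one : frameB (N := 2) 1 1 = -frameB 0 0 := by
  have hC1 : frameC (N := 2) 1 1 = (I / 2) • (1 : Matrix (Fin 2) (Fin 2) ℂ) := by simp [frameC]
  have hC0 : frameC (N := 2) 0 0 = (I / 2) • (1 : Matrix (Fin 2) (Fin 2) ℂ) := by simp [frameC]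
  rw [frameB, frameB, hC1, hC0, frameB0, frameB0, ← E_zero_zero_add_E_one_one]
  module

/-- **The frame of `𝔰𝔲(2)` enumerated**: for `g` even with `g 0 = 0`, the sum over the eight frame
directions is twice the sum over the three core directions `frameA 0 1`, `frameB 0 1`, `frameB 0 0`.
[folklore] -/
theorem sum_frame_two {g : Matrix (Fin 2) (Fin 2) ℂ → ℝ} (hneg : ∀ X, g (-X) = g X) (h0 : g 0 = 0) :
    ∑ α, g (frame (N := 2) α) = 2 * (g (frameA 0 1) + g (frameB 0 1) + g (frameB 0 0)) := by
  rw [sum_frame]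
  simp only [Fin.sum_univ_two, frameA_self, frameA_one_zero, frameB_one_zero, frameB_one_one, hneg, h0]
  ring

/-- **Sum of squares = symmetric part + antisymmetric part.** [folklore] -/
private theorem sum_sum_sq_eq_sym_add_anti {ι : Type*} [Fintype ι] (m : ι → ι → ℝ) :
    ∑ α, ∑ β, m α β ^ 2 =
      (1 / 4) * ∑ α, ∑ β, (m α β + m β α) ^ 2 + (1 / 4) * ∑ α, ∑ β, (m α β - m β α) ^ 2 := by
  have h : (1 / 4) * ∑ α, ∑ β, (m α β + m β α) ^ 2 + (1 / 4) * ∑ α, ∑ β, (m α β - m β α) ^ 2 =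
      (1 / 2) * ∑ α, ∑ β, m α β ^ 2 + (1 / 2) * ∑ α, ∑ β, m β α ^ 2 := by
    rw [mul_sum, mul_sum, mul_sum, mul_sum, ← sum_add_distrib, ← sum_add_distrib]
    refine sum_congr rfl fun α _ => ?_
    rw [mul_sum, mul_sum, mul_sum, mul_sum, ← sum_add_distrib, ← sum_add_distrib]
    refine sum_congr rfl fun β _ => ?_
    ring
  rw [h, sum_comm (f := fun α β => m β α ^ 2)]
  ring


/-! ## Part B: second-order calculus in the frame at `N = 2` -/

section Calculus

attribute [local instance 2000] matTop

/-- `D_0 = 0`. [folklore] -/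
private theorem matD_zero_dir (F : Matrix (Fin 2) (Fin 2) ℂ → ℝ) : matD (0 : Matrix (Fin 2) (Fin 2) ℂ) F = 0 := by
  funext Q
  simp [matD_apply]

variable {u : Matrix (Fin 2) (Fin 2) ℂ → ℝ}

/-- `D_{-X} D_Y u = -D_X D_Y u`. [folklore] -/
private theorem matD_matD_neg_left (X Y Q : Matrix (Fin 2) (Fin 2) ℂ) :
    matD (-X) (matD Y u) Q = -matD X (matD Y u) Q := by
  rw [matD_neg_dir]; rfl

/-- `D_X D_{-Y} u = -D_X D_Y u`. [folklore] -/
private theorem matD_matD_neg_right (hu : ContDiff ℝ ∞ u) (X Y Q : Matrix (Fin 2) (Fin 2) ℂ) :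
    matD X (matD (-Y) u) Q = -matD X (matD Y u) Q := by
  rw [matD_neg_dir Y u]
  have e : -matD Y u = fun Q => (-1 : ℝ) * matD Y u Q := by funext Q; simp
  rw [e, matD_const_mul (contDiff_matD hu Y) (-1)]
  simp

/-- `D_0 D_Y u = 0`. [folklore] -/
private theorem matD_matD_zero_left (Y Q : Matrix (Fin 2) (Fin 2) ℂ) : matD 0 (matD Y u) Q = 0 := by
  rw [matD_zero_dir]; rfl

/-- `D_X D_0 u = 0`. [folklore] -/
private theorem matD_matD_zero_right (X Q : Matrix (Fin 2) (Fin 2) ℂ) : matD X (matD 0 u) Q = 0 := by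
  rw [matD_zero_dir]
  have e : matD X (0 : Matrix (Fin 2) (Fin 2) ℂ → ℝ) = 0 := matD_const 0 X
  rw [e]; rfl

/-- **The Laplacian of `SU(2)` on the three core directions**:
`Δu = 2 (D_A D_A u + D_B D_B u + D_C D_C u)`. [folklore] -/
theorem Lap_two (hu : ContDiff ℝ ∞ u) (Q : Matrix (Fin 2) (Fin 2) ℂ) :
    Lap u Q = 2 * (matD (frameA 0 1) (matD (frameA 0 1) u) Q + matD (frameB 0 1) (matD (frameB 0 1) u) Q +
      matD (frameB 0 0) (matD (frameB 0 0) u) Q) := by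
  show (∑ α, matD (frame α) (matD (frame α) u) Q) = _
  refine sum_frame_two (g := fun Y => matD Y (matD Y u) Q) (fun X => ?_) ?_
  · show matD (-X) (matD (-X) u) Q = matD X (matD X u) Q
    rw [matD_matD_neg_left, matD_matD_neg_right hu, neg_neg]
  · exact matD_matD_zero_left (u := u) 0 Q

/-- The symmetrised second derivatives summed over the frame, reduced to the core. [folklore] -/
theorem sum_sum_sym_sq_two (hu : ContDiff ℝ ∞ u) (Q : Matrix (Fin 2) (Fin 2) ℂ) :
    ∑ α, ∑ β, (matD (frame α) (matD (frame β) u) Q + matD (frame β) (matD (frame α) u) Q) ^ 2 =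
      4 * ((2 * matD (frameA 0 1) (matD (frameA 0 1) u) Q) ^ 2 + (2 * matD (frameB 0 1) (matD (frameB 0 1) u) Q) ^ 2 +
        (2 * matD (frameB 0 0) (matD (frameB 0 0) u) Q) ^ 2 +
        2 * (matD (frameA 0 1) (matD (frameB 0 1) u) Q + matD (frameB 0 1) (matD (frameA 0 1) u) Q) ^ 2 +
        2 * (matD (frameA 0 1) (matD (frameB 0 0) u) Q + matD (frameB 0 0) (matD (frameA 0 1) u) Q) ^ 2 +
        2 * (matD (frameB 0 1) (matD (frameB 0 0) u) Q + matD (frameB 0 0) (matD (frameB 0 1) u) Q) ^ 2) := by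
  -- inner sums
  have hin : ∀ X : Matrix (Fin 2) (Fin 2) ℂ, ∑ β, (matD X (matD (frame β) u) Q + matD (frame β) (matD X u) Q) ^ 2 =
      2 * ((matD X (matD (frameA 0 1) u) Q + matD (frameA 0 1) (matD X u) Q) ^ 2 +
        (matD X (matD (frameB 0 1) u) Q + matD (frameB 0 1) (matD X u) Q) ^ 2 +
        (matD X (matD (frameB 0 0) u) Q + matD (frameB 0 0) (matD X u) Q) ^ 2) := by
    intro X
    refine sum_frame_two (g := fun Y => (matD X (matD Y u) Q + matD Y (matD X u) Q) ^ 2) (fun Y => ?_) ?_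
    · show (matD X (matD (-Y) u) Q + matD (-Y) (matD X u) Q) ^ 2 = (matD X (matD Y u) Q + matD Y (matD X u) Q) ^ 2
      rw [matD_matD_neg_right hu, matD_matD_neg_left]; ring
    · show (matD X (matD 0 u) Q + matD 0 (matD X u) Q) ^ 2 = 0
      rw [matD_matD_zero_right, matD_matD_zero_left]; ring
  simp_rw [hin]
  rw [sum_frame_two (g := fun X => 2 * ((matD X (matD (frameA 0 1) u) Q + matD (frameA 0 1) (matD X u) Q) ^ 2 +
        (matD X (matD (frameB 0 1) u) Q + matD (frameB 0 1) (matD X u) Q) ^ 2 +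
        (matD X (matD (frameB 0 0) u) Q + matD (frameB 0 0) (matD X u) Q) ^ 2))]
  · ring
  · intro X
    show 2 * ((matD (-X) (matD (frameA 0 1) u) Q + matD (frameA 0 1) (matD (-X) u) Q) ^ 2 +
        (matD (-X) (matD (frameB 0 1) u) Q + matD (frameB 0 1) (matD (-X) u) Q) ^ 2 +
        (matD (-X) (matD (frameB 0 0) u) Q + matD (frameB 0 0) (matD (-X) u) Q) ^ 2) = _
    rw [matD_matD_neg_left, matD_matD_neg_left, matD_matD_neg_left, matD_matD_neg_right hu,
      matD_matD_neg_right hu, matD_matD_neg_right hu]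
    ring
  · show 2 * ((matD 0 (matD (frameA 0 1) u) Q + matD (frameA 0 1) (matD 0 u) Q) ^ 2 +
        (matD 0 (matD (frameB 0 1) u) Q + matD (frameB 0 1) (matD 0 u) Q) ^ 2 +
        (matD 0 (matD (frameB 0 0) u) Q + matD (frameB 0 0) (matD 0 u) Q) ^ 2) = 0
    rw [matD_matD_zero_left, matD_matD_zero_left, matD_matD_zero_left, matD_matD_zero_right,
      matD_matD_zero_right, matD_matD_zero_right]
    ring

/-- **The dimensional term** (`dim SU(2) = 3`, `Ric = 1`): `Γ(u,u) + (Δu)²/3 ≤ ∑_{αβ} (D_α D_β u)²`.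
[folklore] -/
theorem Gam_add_Lap_sq_le (hu : ContDiff ℝ ∞ u) (Q : Matrix (Fin 2) (Fin 2) ℂ) :
    Gam u u Q + Lap u Q ^ 2 / 3 ≤ ∑ α, ∑ β, matD (frame α) (matD (frame β) u) Q ^ 2 := by
  rw [sum_sum_sq_eq_sym_add_anti (fun α β => matD (frame α) (matD (frame β) u) Q)]
  have hanti := sum_sum_sq_comm_matD (N := 2) two_ne_zero hu Q
  simp only [Nat.cast_ofNat] at hanti
  rw [hanti, sum_sum_sym_sq_two hu Q, Lap_two hu Q]
  nlinarith [sq_nonneg (matD (frameA 0 1) (matD (frameA 0 1) u) Q - matD (frameB 0 1) (matD (frameB 0 1) u) Q),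
    sq_nonneg (matD (frameA 0 1) (matD (frameA 0 1) u) Q - matD (frameB 0 0) (matD (frameB 0 0) u) Q),
    sq_nonneg (matD (frameB 0 1) (matD (frameB 0 1) u) Q - matD (frameB 0 0) (matD (frameB 0 0) u) Q),
    sq_nonneg (matD (frameA 0 1) (matD (frameB 0 1) u) Q + matD (frameB 0 1) (matD (frameA 0 1) u) Q),
    sq_nonneg (matD (frameA 0 1) (matD (frameB 0 0) u) Q + matD (frameB 0 0) (matD (frameA 0 1) u) Q),
    sq_nonneg (matD (frameB 0 1) (matD (frameB 0 0) u) Q + matD (frameB 0 0) (matD (frameB 0 1) u) Q)]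

/-- **The `N = 2` Hessian term of the one-link potential is exact**:
`∑_{αβ} D_α u D_β u D_α D_β S = -(S/2) Γ(u,u)` for `S = c Re tr(· B)`. [folklore] -/
theorem sum_sum_hess_potential_two (c : ℝ) (B Q : Matrix (Fin 2) (Fin 2) ℂ) :
    ∑ α, ∑ β, matD (frame α) u Q * matD (frame β) u Q *
        matD (frame α) (matD (frame β) (fun Q => c * (Q * B).trace.re)) Q =
      -(1 / 2) * (c * (Q * B).trace.re) * Gam u u Q := by
  rw [sum_sum_hess_potential, re_trace_mul_mul_mul_of_su2 (frameGrad_conjTranspose _) (frameGrad_trace two_ne_zero _),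
    Gam_self_eq_frobNorm_sq two_ne_zero u Q]
  ring

end Calculus


/-! ## Part C: the carré du champ of the potential, the pointwise and the integrated
curvature–dimension inequality -/

section Calculus

attribute [local instance 2000] matTop

/-- `Re((1/2) z) = Re z / 2`. [folklore] -/
private theorem re_half_mul (z : ℂ) : ((1 / 2 : ℂ) * z).re = z.re / 2 := by
  simp [Complex.mul_re]; ring

/-- `Re((i/2) z) = -Im z / 2`. [folklore] -/
private theorem re_I_half_mul (z : ℂ) : ((I / 2) * z).re = -(z.im / 2) := by
  simp [Complex.mul_re]; ring

/-- **The carré du champ of the one-link potential on `SU(2)`**: for unitary `Q` and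
`S = c Re tr(· B)`, `Γ(S,S)(Q) + S(Q)²/2 ≤ c² ‖B‖_F²` (Bessel's inequality for the orthogonal family
`𝔰𝔲(2) ⊕ ℝ·1 ⊂ M₂(ℂ)` applied to `c B Q`). [folklore] -/
theorem Gam_potential_add_sq_le (c : ℝ) (B : Matrix (Fin 2) (Fin 2) ℂ) {Q : Matrix (Fin 2) (Fin 2) ℂ}
    (hQ : Q ∈ Matrix.unitaryGroup (Fin 2) ℂ) :
    Gam (fun Q => c * (Q * B).trace.re) (fun Q => c * (Q * B).trace.re) Q + (c * (Q * B).trace.re) ^ 2 / 2 ≤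
      c ^ 2 * frobNorm B ^ 2 := by
  rw [Gam_self_eq_sum_sq]
  simp only [matD_const_mul_reTrMul]
  rw [sum_frame_two (g := fun Y => (c * (Q * Y * B).trace.re) ^ 2)]
  rotate_left
  · intro X
    show (c * (Q * -X * B).trace.re) ^ 2 = (c * (Q * X * B).trace.re) ^ 2
    rw [Matrix.mul_neg, Matrix.neg_mul, trace_neg, Complex.neg_re]; ring
  · show (c * (Q * 0 * B).trace.re) ^ 2 = 0
    rw [Matrix.mul_zero, Matrix.zero_mul, trace_zero, Complex.zero_re]; ring
  -- everything in terms of `W = B Q`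
  set W : Matrix (Fin 2) (Fin 2) ℂ := B * Q with hW
  have hcyc : ∀ Y : Matrix (Fin 2) (Fin 2) ℂ, (Q * Y * B).trace = (Y * W).trace := by
    intro Y; rw [Matrix.trace_mul_cycle, hW, Matrix.trace_mul_comm]
  have hA : (Q * frameA 0 1 * B).trace.re = ((W 1 0).re - (W 0 1).re) / 2 := by
    rw [hcyc, frameA, smul_mul_assoc, trace_smul, sub_mul, trace_sub, trace_E_mul, trace_E_mul, smul_eq_mul,
      re_half_mul, Complex.sub_re]
  have hB : (Q * frameB 0 1 * B).trace.re = -(((W 1 0).im + (W 0 1).im) / 2) := by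
    rw [hcyc, frameB, sub_mul, trace_sub, trace_frameB0_mul, trace_frameC_mul]
    simp
    ring
  have hC : (Q * frameB 0 0 * B).trace.re = -(((W 0 0).im - (W 1 1).im) / 2) := by
    rw [hcyc, frameB, sub_mul, trace_sub, trace_frameB0_mul, trace_frameC_mul]
    simp only [if_true, Nat.cast_ofNat, Matrix.trace_fin_two, Complex.sub_re, re_I_half_mul, Complex.add_im]
    ring
  have hS : (Q * B).trace.re = (W 0 0).re + (W 1 1).re := by
    rw [Matrix.trace_mul_comm, ← hW, Matrix.trace_fin_two, Complex.add_re]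
  have hF : frobNorm B ^ 2 = ((W 0 0).re ^ 2 + (W 0 0).im ^ 2) + ((W 0 1).re ^ 2 + (W 0 1).im ^ 2) +
      (((W 1 0).re ^ 2 + (W 1 0).im ^ 2) + ((W 1 1).re ^ 2 + (W 1 1).im ^ 2)) := by
    rw [← frobNorm_mul_unitary B hQ, ← hW, frobNorm_sq]
    simp only [Fin.sum_univ_two, Complex.sq_norm, Complex.normSq_apply]
    ring
  rw [hA, hB, hC, hS, hF]
  nlinarith [sq_nonneg ((W 1 0).re + (W 0 1).re), sq_nonneg ((W 1 0).im - (W 0 1).im),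
    sq_nonneg ((W 0 0).im + (W 1 1).im), sq_nonneg ((W 0 0).re - (W 1 1).re), sq_nonneg c]

variable {u : Matrix (Fin 2) (Fin 2) ℂ → ℝ}

/-- **Pointwise curvature–dimension inequality for the one-link potential on `SU(2)`** (product
form): for unitary `Q`, smooth `u`, `S = c Re tr(· B)`, `P = c²‖B‖_F²` and every `t > 0`,
`(8t - t² - 8P)(t + 3) Γ(u,u) + 8t (L_S u)² ≤ 8t(t + 3) Γ₂^S(u)` at `Q` — i.e.
`Γ₂ ≥ (1 - t/8 - P/t) Γ + (L_S u)²/(t+3)`, the condition `CD(1 - t/8 - P/t, t + 3)`; Bakry–Émery's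
`CD(1 - κ/2, ∞)` (`κ = sup S`) is the limit `t → ∞` after the cruder Hessian bound. Ingredients:
Bochner's formula in the frame, the exact `N = 2` Hessian `-(S/2)Γ`, the dimensional term
`(Δu)²/3`, and `Γ(S,u)² ≤ Γ(S,S)Γ(u,u) ≤ (P - S²/2)Γ(u,u)`. [folklore] -/
theorem Gam2_potential_ge_dim (c : ℝ) (B : Matrix (Fin 2) (Fin 2) ℂ) (hu : ContDiff ℝ ∞ u)
    {Q : Matrix (Fin 2) (Fin 2) ℂ} (hQ : Q ∈ Matrix.unitaryGroup (Fin 2) ℂ) {t : ℝ} (ht : 0 < t) :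
    (8 * t - t ^ 2 - 8 * (c ^ 2 * frobNorm B ^ 2)) * (t + 3) * Gam u u Q +
        8 * t * genL (fun Q => c * (Q * B).trace.re) u Q ^ 2 ≤
      8 * t * (t + 3) * Gam2 (fun Q => c * (Q * B).trace.re) u Q := by
  set S : Matrix (Fin 2) (Fin 2) ℂ → ℝ := fun Q => c * (Q * B).trace.re with hSdef
  have hS : ContDiff ℝ ∞ S := contDiff_potential c B
  -- Bochner + exact Hessian + dimensional term
  have step1 : Gam u u Q + Lap u Q ^ 2 / 3 + (1 / 2) * S Q * Gam u u Q ≤ Gam2 S u Q := by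
    rw [Gam2_eq two_ne_zero hS hu, hSdef, sum_sum_hess_potential_two]
    have h := Gam_add_Lap_sq_le hu Q
    linarith
  have hL : genL S u Q = Lap u Q + Gam S u Q := rfl
  -- `Γ(S,u)² ≤ Γ(S,S) Γ(u,u) ≤ (P - S²/2) Γ(u,u)`
  have hΓ0 : 0 ≤ Gam u u Q := Gam_self_nonneg u Q
  have hSS0 : 0 ≤ Gam S S Q := Gam_self_nonneg S Q
  have hG2 : Gam S u Q ^ 2 ≤ Gam S S Q * Gam u u Q := by
    have h := abs_Gam_le S u Q
    have h0 : 0 ≤ Real.sqrt (Gam S S Q) * Real.sqrt (Gam u u Q) := by positivity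
    calc Gam S u Q ^ 2 = |Gam S u Q| ^ 2 := (sq_abs _).symm
      _ ≤ (Real.sqrt (Gam S S Q) * Real.sqrt (Gam u u Q)) ^ 2 := pow_le_pow_left₀ (abs_nonneg _) h 2
      _ = Gam S S Q * Gam u u Q := by
          rw [mul_pow, Real.sq_sqrt hSS0, Real.sq_sqrt hΓ0]
  have hSS : Gam S S Q ≤ c ^ 2 * frobNorm B ^ 2 - S Q ^ 2 / 2 := by
    have h := Gam_potential_add_sq_le c B hQ
    simp only [hSdef] at h ⊢
    linarith
  have hG2' : Gam S u Q ^ 2 ≤ (c ^ 2 * frobNorm B ^ 2 - S Q ^ 2 / 2) * Gam u u Q :=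
    hG2.trans (mul_le_mul_of_nonneg_right hSS hΓ0)
  -- the four linear pieces
  have e1 : 8 * t * (t + 3) * (Gam u u Q + Lap u Q ^ 2 / 3 + (1 / 2) * S Q * Gam u u Q) ≤
      8 * t * (t + 3) * Gam2 S u Q := mul_le_mul_of_nonneg_left step1 (by positivity)
  have e2 : 3 * t * (Lap u Q + Gam S u Q) ^ 2 ≤ (t + 3) * (t * Lap u Q ^ 2 + 3 * Gam S u Q ^ 2) := by
    nlinarith [sq_nonneg (t * Lap u Q - 3 * Gam S u Q)]
  have e3 : 8 * (t + 3) * Gam S u Q ^ 2 ≤ 8 * (t + 3) * ((c ^ 2 * frobNorm B ^ 2 - S Q ^ 2 / 2) * Gam u u Q) :=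
    mul_le_mul_of_nonneg_left hG2' (by positivity)
  have e4 : 0 ≤ (t + 3) * Gam u u Q * (t + 2 * S Q) ^ 2 := by positivity
  rw [hL]
  nlinarith [e1, e2, e3, e4]

end Calculus

/-- **Integrated curvature–dimension inequality on `SU(2)`**: for `S = c Re tr(· B)`,
`P = c²‖B‖_F²`, smooth `u` and `t > 0`,
`(8t - t² - 8P)(t + 3) ∫ e^S Γ(u,u) dσ ≤ 8t(t + 2) ∫ e^S (L_S u)² dσ`
(integrate the pointwise inequality against `e^S dσ` and use `∫ e^S (L_S u)² = ∫ e^S Γ₂(u)`).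
For `t → ∞` after dividing by `t²` this degenerates; at finite `t` it BEATS Bakry–Émery's
`(1 - κ/2) ∫ e^S Γ ≤ ∫ e^S (L_S u)²`. [folklore] -/
theorem integral_exp_mul_Gam_le_dim (c : ℝ) (B : Matrix (Fin 2) (Fin 2) ℂ) {u : Matrix (Fin 2) (Fin 2) ℂ → ℝ}
    (hu : ContDiff ℝ ∞ u) {t : ℝ} (ht : 0 < t) :
    (8 * t - t ^ 2 - 8 * (c ^ 2 * frobNorm B ^ 2)) * (t + 3) *
        ∫ g : SUN 2, Real.exp (c * ((g : Matrix (Fin 2) (Fin 2) ℂ) * B).trace.re) * Gam u u g ∂(haarProbability (SUN 2)) ≤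
      8 * t * (t + 2) * ∫ g : SUN 2, Real.exp (c * ((g : Matrix (Fin 2) (Fin 2) ℂ) * B).trace.re) *
        genL (fun Q => c * (Q * B).trace.re) u g ^ 2 ∂(haarProbability (SUN 2)) := by
  set S : Matrix (Fin 2) (Fin 2) ℂ → ℝ := fun Q => c * (Q * B).trace.re with hSdef
  set A : ℝ := (8 * t - t ^ 2 - 8 * (c ^ 2 * frobNorm B ^ 2)) * (t + 3) with hAdef
  have hS : ContDiff ℝ ∞ S := contDiff_potential c B
  have i1 : Integrable (fun g : SUN 2 => Real.exp (S g) * Gam u u g) (haarProbability (SUN 2)) :=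
    integrable_of_continuous_SUN (continuous_restrict (hS.exp.mul (contDiff_Gam hu hu))) _
  have i2 : Integrable (fun g : SUN 2 => Real.exp (S g) * genL S u g ^ 2) (haarProbability (SUN 2)) :=
    integrable_of_continuous_SUN (continuous_restrict (hS.exp.mul ((contDiff_genL hS hu).pow 2))) _
  have i3 : Integrable (fun g : SUN 2 => Real.exp (S g) * Gam2 S u g) (haarProbability (SUN 2)) := by
    have hc : ContDiff ℝ ∞ (Gam2 S u) := by
      have : Gam2 S u = fun Q => (1 / 2) * genL S (Gam u u) Q - Gam u (genL S u) Q := rfl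
      rw [this]
      exact (contDiff_const.mul (contDiff_genL hS (contDiff_Gam hu hu))).sub (contDiff_Gam hu (contDiff_genL hS hu))
    exact integrable_of_continuous_SUN (continuous_restrict (hS.exp.mul hc)) _
  have hpt : ∀ g : SUN 2, A * (Real.exp (S g) * Gam u u g) + 8 * t * (Real.exp (S g) * genL S u g ^ 2) ≤
      8 * t * (t + 3) * (Real.exp (S g) * Gam2 S u g) := by
    intro g
    have h := Gam2_potential_ge_dim c B hu (SUN.mem_unitaryGroup g) ht
    have hw := Real.exp_pos (S g)
    have := mul_le_mul_of_nonneg_left h hw.le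
    simp only [hSdef, hAdef] at this ⊢
    nlinarith [this]
  have hint : A * ∫ g : SUN 2, Real.exp (S g) * Gam u u g ∂(haarProbability (SUN 2)) +
      8 * t * ∫ g : SUN 2, Real.exp (S g) * genL S u g ^ 2 ∂(haarProbability (SUN 2)) ≤
      8 * t * (t + 3) * ∫ g : SUN 2, Real.exp (S g) * Gam2 S u g ∂(haarProbability (SUN 2)) := by
    have i12 : Integrable (fun g : SUN 2 => A * (Real.exp (S g) * Gam u u g) + 8 * t * (Real.exp (S g) * genL S u g ^ 2))
        (haarProbability (SUN 2)) := (i1.const_mul A).add (i2.const_mul (8 * t))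
    have i3' : Integrable (fun g : SUN 2 => 8 * t * (t + 3) * (Real.exp (S g) * Gam2 S u g)) (haarProbability (SUN 2)) :=
      i3.const_mul (8 * t * (t + 3))
    have h := integral_mono i12 i3' hpt
    rw [integral_add (i1.const_mul A) (i2.const_mul (8 * t)), integral_const_mul, integral_const_mul,
      integral_const_mul] at h
    exact h
  rw [← integral_exp_mul_genL_sq two_ne_zero hS hu] at hint
  have e : 8 * t * (t + 2) * ∫ g : SUN 2, Real.exp (S g) * genL S u g ^ 2 ∂(haarProbability (SUN 2)) =
      8 * t * (t + 3) * ∫ g : SUN 2, Real.exp (S g) * genL S u g ^ 2 ∂(haarProbability (SUN 2)) -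
        8 * t * ∫ g : SUN 2, Real.exp (S g) * genL S u g ^ 2 ∂(haarProbability (SUN 2)) := by ring
  simp only [hSdef, hAdef] at hint e ⊢
  linarith

end Summit.QuantumFields.BalabanUV.InfraRed.StrongCouplingDimensionalCurvature

end
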